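import Literature.NumberTheory.Sieve.GoldstonPintzYildirimThetaEuler
import Literature.NumberTheory.Sieve.GoldstonPintzYildirimPairEuler
import Literature.NumberTheory.Sieve.GoldstonPintzYildirimTwoVarG
import HarnessLib

/-!
# Goldston–Pintz–Yıldırım, *Primes in tuples I*, §9 (9.15)–(9.17): the double Dirichlet series of `𝒯̃_R`

Trunk: NumberTheory / Sieve. The `φ`-weighted twin of `GoldstonPintzYildirimTwoVarPerron` /
`GoldstonPintzYildirimTwoVarEuler` / (7.9) of `GoldstonPintzYildirimTwoVarG` for the main term
`𝒯̃_R` of GPY **Proposition 2** (D. A. Goldston, J. Pintz, C. Y. Yıldırım, *Primes in tuples. I*,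
Ann. of Math. 170 (2009) = arXiv:math/0508185, §9, p. 19):

  `F(s₁,s₂) = ∑_{d,e} μ(d)μ(e) (ν*ν*ν̄*)(d,e)/φ([d,e]) · d^{−s₁} e^{−s₂}`     ((9.16), left)
           `= ∏_p (1 − ν*_p(H₁⁰)/((p−1)p^{s₁}) − ν*_p(H₂⁰)/((p−1)p^{s₂}) + ν̄*_p/((p−1)p^{s₁+s₂}))` ((9.16), right)
           `= G(s₁,s₂) ζ(1+s₁+s₂)^d /(ζ(1+s₁)^a ζ(1+s₂)^b)`                  ((9.17)–(9.19)).

Everything here is PROVED: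

* `Literature.NumberTheory.Sieve.GPY.pairCoeffStar h₀ H₁ H₂ d e = μ(d)μ(e) nuJointStar(d,e)/φ([d,e])` — the coefficients;
  `nuJointStar_mul_mul`, `totient_lcm_mul_mul`, `pairCoeffStar_mul_mul` (pair-multiplicativity);
  `abs_pairCoeffStar_le` — `|c*(d,e)| ≤ K'² (de)^{−1/4}`, `K' = (2k)^{(2k)⁴}`, `k = k₁ + k₂ ≥ 1`
  (`nuJointStar ≤ nuJoint ≤ d_k(d)d_k(e)`, `[d,e] ≤ d_2(d)d_2(e) φ([d,e])`, `d_{2k} ≤ K' n^{1/4}`),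
  `summable_abs_pairCoeffStar_div`;
* `Literature.NumberTheory.Sieve.GPY.FDir₂StarTerm`, `Literature.NumberTheory.Sieve.GPY.FDir₂Star` — the
  series (9.16) as a `tsum` over `ℕ × ℕ`, absolutely convergent for `Re sᵢ ≥ 1`
  (`summable_norm_FDir₂StarTerm`);
* `hasProd_starFactor` — **(9.16)**: `HasProd (p ↦ starFactor p s₁ s₂) (F(s₁,s₂))` for
  `Re sᵢ ≥ 1`, by the generic `hasProd_one_add_pair` of `GoldstonPintzYildirimPairEuler`;
* `hasProd_starGFactor_of_one_le`, **`FDir₂Star_eq_GStar_mul`** — **(9.17)–(9.19)**: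
  `F = G ζ(1+s₁+s₂)^d/(ζ(1+s₁)^a ζ(1+s₂)^b)` for `Re sᵢ ≥ 1`, with `(a,b,d)` the case exponents.

The double Perron representation (9.15) of `𝒯̃_R = mainTRTheta` is the subject of the sequel.

## References

* D. A. Goldston, J. Pintz, C. Y. Yıldırım, *Primes in tuples. I*, Ann. of Math. (2) 170 (2009),
  819–862 = arXiv:math/0508185, §9 (9.15)–(9.19), p. 19. [cite: GoldstonPintzYildirim2009]
-/

noncomputable section

open Finset
open scoped ArithmeticFunction.Moebius ArithmeticFunction.omega

namespace Literature.NumberTheory.Sieve.GPY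

/-! ### The coefficients `c*(d,e) = μ(d)μ(e) nuJointStar(d,e)/φ([d,e])` -/

/-- The coefficient of `d^{−s₁}e^{−s₂}` in the series (9.16) of `𝒯̃_R`:
`c*(d,e) = μ(d)μ(e) · ν*_{a₁}(H₁⁰)ν*_{a₂}(H₂⁰)ν̄*_{a₁₂}/φ(a₁a₂a₁₂)` (`[d,e] = a₁a₂a₁₂`; the summand of
`mainTRTheta` stripped of its logarithms). [cite: GoldstonPintzYildirim2009, Section 9 eq. 9.16] -/
def pairCoeffStar (h₀ : ℕ) (H₁ H₂ : Finset ℕ) (d e : ℕ) : ℝ :=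
  (μ d : ℝ) * (μ e : ℝ) * (nuJointStar h₀ H₁ H₂ d e / Nat.totient (Nat.lcm d e) : ℝ)

/-- `c*(0,e) = 0`. [folklore] -/
theorem pairCoeffStar_zero_left (h₀ : ℕ) (H₁ H₂ : Finset ℕ) (e : ℕ) :
    pairCoeffStar h₀ H₁ H₂ 0 e = 0 := by
  simp [pairCoeffStar]

/-- `c*(d,0) = 0`. [folklore] -/
theorem pairCoeffStar_zero_right (h₀ : ℕ) (H₁ H₂ : Finset ℕ) (d : ℕ) :
    pairCoeffStar h₀ H₁ H₂ d 0 = 0 := by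
  simp [pairCoeffStar]

/-- `nuJointStar(1,1) = 1`. [folklore] -/
theorem nuJointStar_one_one (h₀ : ℕ) (H₁ H₂ : Finset ℕ) : nuJointStar h₀ H₁ H₂ 1 1 = 1 := by
  simp [nuJointStar]

/-- `c*(1,1) = 1`. [folklore] -/
theorem pairCoeffStar_one_one (h₀ : ℕ) (H₁ H₂ : Finset ℕ) : pairCoeffStar h₀ H₁ H₂ 1 1 = 1 := by
  simp [pairCoeffStar, nuJointStar_one_one]

/-- **`nuJointStar` is multiplicative in the pair**: for `(m,n) = 1`, `d₁, e₁ ∣ m`, `d₂, e₂ ∣ n`,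
`nuJointStar(d₁d₂, e₁e₂) = nuJointStar(d₁,e₁) · nuJointStar(d₂,e₂)` (the twin of `nuJoint_mul_mul`).
[cite: GoldstonPintzYildirim2009, Section 9 eq. 9.11] -/
theorem nuJointStar_mul_mul (h₀ : ℕ) (H₁ H₂ : Finset ℕ) {m n d₁ e₁ d₂ e₂ : ℕ} (hmn : m.Coprime n)
    (hd₁ : d₁ ∣ m) (he₁ : e₁ ∣ m) (hd₂ : d₂ ∣ n) (he₂ : e₂ ∣ n) :
    nuJointStar h₀ H₁ H₂ (d₁ * d₂) (e₁ * e₂) =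
      nuJointStar h₀ H₁ H₂ d₁ e₁ * nuJointStar h₀ H₁ H₂ d₂ e₂ := by
  have h1 : Nat.lcm d₁ e₁ ∣ m := Nat.lcm_dvd hd₁ he₁
  have h2 : Nat.lcm d₂ e₂ ∣ n := Nat.lcm_dvd hd₂ he₂
  have hcop : (Nat.lcm d₁ e₁).Coprime (Nat.lcm d₂ e₂) :=
    (hmn.coprime_dvd_left h1).coprime_dvd_right h2
  unfold nuJointStar
  rw [lcm_mul_mul_of_coprime hmn hd₁ he₁ hd₂ he₂, hcop.primeFactors_mul,
    Finset.prod_union hcop.disjoint_primeFactors]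
  congr 1
  · refine Finset.prod_congr rfl fun p hp => ?_
    have hpp := Nat.prime_of_mem_primeFactors hp
    have hpm : p ∣ m := (Nat.dvd_of_mem_primeFactors hp).trans h1
    unfold nuJointStarPrime
    simp only [prime_dvd_mul_iff_of_coprime hmn hpp hpm hd₂,
      prime_dvd_mul_iff_of_coprime hmn hpp hpm he₂]
  · refine Finset.prod_congr rfl fun p hp => ?_
    have hpp := Nat.prime_of_mem_primeFactors hp
    have hpn : p ∣ n := (Nat.dvd_of_mem_primeFactors hp).trans h2
    unfold nuJointStarPrime
    simp only [prime_dvd_mul_iff_of_coprime' hmn hpp hpn hd₁,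
      prime_dvd_mul_iff_of_coprime' hmn hpp hpn he₁]

/-- `φ([d₁d₂, e₁e₂]) = φ([d₁,e₁]) φ([d₂,e₂])` under the same hypotheses. [folklore] -/
theorem totient_lcm_mul_mul {m n d₁ e₁ d₂ e₂ : ℕ} (hmn : m.Coprime n) (hd₁ : d₁ ∣ m) (he₁ : e₁ ∣ m)
    (hd₂ : d₂ ∣ n) (he₂ : e₂ ∣ n) :
    Nat.totient (Nat.lcm (d₁ * d₂) (e₁ * e₂)) =
      Nat.totient (Nat.lcm d₁ e₁) * Nat.totient (Nat.lcm d₂ e₂) := by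
  have h1 : Nat.lcm d₁ e₁ ∣ m := Nat.lcm_dvd hd₁ he₁
  have h2 : Nat.lcm d₂ e₂ ∣ n := Nat.lcm_dvd hd₂ he₂
  have hcop : (Nat.lcm d₁ e₁).Coprime (Nat.lcm d₂ e₂) :=
    (hmn.coprime_dvd_left h1).coprime_dvd_right h2
  rw [lcm_mul_mul_of_coprime hmn hd₁ he₁ hd₂ he₂, Nat.totient_mul hcop]

/-- **`c*(d,e)` is multiplicative in the pair**.
[cite: GoldstonPintzYildirim2009, Section 9 eq. 9.16] -/
theorem pairCoeffStar_mul_mul (h₀ : ℕ) (H₁ H₂ : Finset ℕ) {m n d₁ e₁ d₂ e₂ : ℕ} (hmn : m.Coprime n)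
    (hd₁ : d₁ ∣ m) (he₁ : e₁ ∣ m) (hd₂ : d₂ ∣ n) (he₂ : e₂ ∣ n) :
    pairCoeffStar h₀ H₁ H₂ (d₁ * d₂) (e₁ * e₂) =
      pairCoeffStar h₀ H₁ H₂ d₁ e₁ * pairCoeffStar h₀ H₁ H₂ d₂ e₂ := by
  have hdd : d₁.Coprime d₂ := (hmn.coprime_dvd_left hd₁).coprime_dvd_right hd₂
  have hee : e₁.Coprime e₂ := (hmn.coprime_dvd_left he₁).coprime_dvd_right he₂
  unfold pairCoeffStar
  rw [ArithmeticFunction.isMultiplicative_moebius.map_mul_of_coprime hdd,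
    ArithmeticFunction.isMultiplicative_moebius.map_mul_of_coprime hee,
    nuJointStar_mul_mul h₀ H₁ H₂ hmn hd₁ he₁ hd₂ he₂, totient_lcm_mul_mul hmn hd₁ he₁ hd₂ he₂]
  push_cast
  rw [mul_div_mul_comm]
  ring

/-! ### The coefficient bound -/

/-- For squarefree `d`, `e`: `[d,e] ≤ d_2(d) d_2(e) φ([d,e])` (`[d,e]` is squarefree,
`q ≤ d_2(q)φ(q)` and `d_2([d,e]) ≤ d_2(d)d_2(e)`). [folklore] -/
theorem lcm_le_dGen_mul_totient {d e : ℕ} (hd : Squarefree d) (he : Squarefree e) :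
    (Nat.lcm d e : ℝ) ≤ dGen 2 d * dGen 2 e * Nat.totient (Nat.lcm d e) := by
  have hd0 := hd.ne_zero
  have he0 := he.ne_zero
  have hsq : Squarefree (Nat.lcm d e) := by
    rw [Nat.squarefree_iff_factorization_le_one (Nat.lcm_ne_zero hd0 he0)]
    intro p
    rw [Nat.factorization_lcm hd0 he0, Finsupp.sup_apply]
    exact sup_le ((Nat.squarefree_iff_factorization_le_one hd0).mp hd p)
      ((Nat.squarefree_iff_factorization_le_one he0).mp he p)
  -- `q ≤ d_2(q) φ(q)` for the squarefree `q = [d,e]` (the lemma of `GoldstonPintzYildirimThetaBV`,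
  -- not imported here)
  have h1 : (Nat.lcm d e : ℝ) ≤ dGen 2 (Nat.lcm d e) * Nat.totient (Nat.lcm d e) := by
    set q := Nat.lcm d e with hqdef
    have hq0 := hsq.ne_zero
    have hprodq : ∏ p ∈ q.primeFactors, p = q := Nat.prod_primeFactors_of_squarefree hsq
    have hφ : Nat.totient q = ∏ p ∈ q.primeFactors, (p - 1) := by
      have h := Nat.totient_mul_prod_primeFactors q
      rw [hprodq, mul_comm q] at h
      exact Nat.eq_of_mul_eq_mul_right (Nat.pos_of_ne_zero hq0) h
    have hωq : ω q = q.primeFactors.card := by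
      rw [ArithmeticFunction.cardDistinctFactors_apply, Nat.primeFactors, List.card_toFinset]
    rw [dGen, hωq, hφ, ← Finset.prod_const]
    push_cast
    rw [← Finset.prod_mul_distrib]
    conv_lhs => rw [← hprodq]
    push_cast
    refine Finset.prod_le_prod (fun p _ => Nat.cast_nonneg p) fun p hp => ?_
    have hp2 := (Nat.prime_of_mem_primeFactors hp).two_le
    have hcast : ((p - 1 : ℕ) : ℝ) = (p : ℝ) - 1 := by
      rw [Nat.cast_sub (by omega)]; simp
    rw [hcast]
    have hp' : (2 : ℝ) ≤ p := by exact_mod_cast hp2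
    linarith
  have hω : dGen 2 (Nat.lcm d e) ≤ dGen 2 d * dGen 2 e := by
    unfold dGen
    have hω' : ∀ n : ℕ, ω n = n.primeFactors.card := fun n => by
      rw [ArithmeticFunction.cardDistinctFactors_apply, Nat.primeFactors, List.card_toFinset]
    rw [hω', hω', hω', ← pow_add]
    refine pow_le_pow_right₀ (by norm_num) ?_
    have hsub : (Nat.lcm d e).primeFactors ⊆ d.primeFactors ∪ e.primeFactors := by
      intro p hp
      have hpp := Nat.prime_of_mem_primeFactors hp
      rcases (Nat.Prime.dvd_mul hpp).1 ((Nat.dvd_of_mem_primeFactors hp).trans (Nat.lcm_dvd_mul d e))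
        with h | h
      · exact Finset.mem_union_left _ (Nat.mem_primeFactors.2 ⟨hpp, h, hd0⟩)
      · exact Finset.mem_union_right _ (Nat.mem_primeFactors.2 ⟨hpp, h, he0⟩)
    exact (Finset.card_le_card hsub).trans (Finset.card_union_le _ _)
  have hφ0 : (0 : ℝ) ≤ Nat.totient (Nat.lcm d e) := Nat.cast_nonneg _
  exact h1.trans (mul_le_mul_of_nonneg_right hω hφ0)

/-- **Coefficient bound**: `|c*(d,e)| ≤ K'² (de)^{−1/4}` for `d, e ≥ 1`, `k = k₁ + k₂ ≥ 1`,
`K' = (2k)^{(2k)⁴}`: `nuJointStar ≤ nuJoint ≤ d_k(d)d_k(e)`, `1/φ([d,e]) ≤ d_2(d)d_2(e)/[d,e]`,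
`d_k d_2 = d_{2k} ≤ K' n^{1/4}`, `[d,e](d,e) = de`, `(d,e) ≤ √(de)` (twin of `abs_pairCoeff_le`).
[cite: GoldstonPintzYildirim2009, Section 9 eq. 9.16] -/
theorem abs_pairCoeffStar_le (h₀ : ℕ) (H₁ H₂ : Finset ℕ) (hk : 1 ≤ #H₁ + #H₂) {d e : ℕ} (hd : d ≠ 0)
    (he : e ≠ 0) :
    |pairCoeffStar h₀ H₁ H₂ d e| ≤
      ((2 * (#H₁ + #H₂) : ℕ) : ℝ) ^ ((2 * (#H₁ + #H₂)) ^ 4) *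
        ((2 * (#H₁ + #H₂) : ℕ) : ℝ) ^ ((2 * (#H₁ + #H₂)) ^ 4) * (((d : ℝ) * e) ^ (1 / 4 : ℝ))⁻¹ := by
  set k : ℕ := #H₁ + #H₂ with hkdef
  set K : ℝ := ((2 * k : ℕ) : ℝ) ^ ((2 * k) ^ 4) with hKdef
  have hK0 : 0 ≤ K := by positivity
  have hd0 : (0 : ℝ) < d := by exact_mod_cast Nat.pos_of_ne_zero hd
  have he0 : (0 : ℝ) < e := by exact_mod_cast Nat.pos_of_ne_zero he
  have hde : (0 : ℝ) < (d : ℝ) * e := mul_pos hd0 he0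
  -- non-squarefree pairs have `c* = 0`
  by_cases hsd : Squarefree d
  swap
  · have : pairCoeffStar h₀ H₁ H₂ d e = 0 := by
      simp [pairCoeffStar, ArithmeticFunction.moebius_eq_zero_of_not_squarefree hsd]
    rw [this, abs_zero]; positivity
  by_cases hse : Squarefree e
  swap
  · have : pairCoeffStar h₀ H₁ H₂ d e = 0 := by
      simp [pairCoeffStar, ArithmeticFunction.moebius_eq_zero_of_not_squarefree hse]
    rw [this, abs_zero]; positivity
  have hμd : |(μ d : ℝ)| ≤ 1 := by exact_mod_cast ArithmeticFunction.abs_moebius_le_one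
  have hμe : |(μ e : ℝ)| ≤ 1 := by exact_mod_cast ArithmeticFunction.abs_moebius_le_one
  have hlcm0 : (0 : ℝ) < Nat.lcm d e := by exact_mod_cast Nat.pos_of_ne_zero (Nat.lcm_ne_zero hd he)
  have hφ0 : (0 : ℝ) < Nat.totient (Nat.lcm d e) := by
    exact_mod_cast Nat.totient_pos.2 (Nat.pos_of_ne_zero (Nat.lcm_ne_zero hd he))
  -- `nuJointStar/φ([d,e]) ≤ d_{2k}(d) d_{2k}(e)/[d,e]`
  have hν : (nuJointStar h₀ H₁ H₂ d e : ℝ) ≤ dGen k d * dGen k e := by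
    have h1 : (nuJointStar h₀ H₁ H₂ d e : ℝ) ≤ nuJoint H₁ H₂ d e := by
      exact_mod_cast nuJointStar_le_nuJoint hsd hse h₀ H₁ H₂
    have h2 : (nuJoint H₁ H₂ d e : ℝ) ≤ dGen k d * dGen k e := by
      simpa only [hkdef, Nat.cast_add] using nuJoint_le H₁ H₂ hk hd he
    exact h1.trans h2
  have hratio : (nuJointStar h₀ H₁ H₂ d e / Nat.totient (Nat.lcm d e) : ℝ) ≤
      dGen ((2 * k : ℕ) : ℝ) d * dGen ((2 * k : ℕ) : ℝ) e / Nat.lcm d e := by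
    rw [div_le_div_iff₀ hφ0 hlcm0]
    have hL := lcm_le_dGen_mul_totient hsd hse
    have hmul : dGen k d * dGen k e * (dGen 2 d * dGen 2 e) =
        dGen ((2 * k : ℕ) : ℝ) d * dGen ((2 * k : ℕ) : ℝ) e := by
      simp only [dGen]
      push_cast
      ring
    calc (nuJointStar h₀ H₁ H₂ d e : ℝ) * Nat.lcm d e
        ≤ (dGen k d * dGen k e) * (dGen 2 d * dGen 2 e * Nat.totient (Nat.lcm d e)) :=
          mul_le_mul hν hL hlcm0.le (mul_nonneg (pow_nonneg (Nat.cast_nonneg _) _)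
            (pow_nonneg (Nat.cast_nonneg _) _))
      _ = dGen ((2 * k : ℕ) : ℝ) d * dGen ((2 * k : ℕ) : ℝ) e * Nat.totient (Nat.lcm d e) := by
          rw [← hmul]; ring
  -- `d_{2k}(n) ≤ K n^{1/4}`
  have h2k : 1 ≤ 2 * k := by omega
  have hνd : dGen ((2 * k : ℕ) : ℝ) d ≤ K * (d : ℝ) ^ (1 / 4 : ℝ) := dGen_le_mul_rpow_quarter h2k hd
  have hνe : dGen ((2 * k : ℕ) : ℝ) e ≤ K * (e : ℝ) ^ (1 / 4 : ℝ) := dGen_le_mul_rpow_quarter h2k he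
  -- `|c*| ≤ (stuff)/[d,e] = (stuff)·gcd/(de)`
  have hgcd : (Nat.gcd d e : ℝ) ≤ ((d : ℝ) * e) ^ (1 / 2 : ℝ) := by
    have := gcd_le_sqrt_mul hd he
    rwa [Real.sqrt_eq_rpow] at this
  have hprod : (Nat.gcd d e : ℝ) * Nat.lcm d e = (d : ℝ) * e := by exact_mod_cast Nat.gcd_mul_lcm d e
  have h1 : |pairCoeffStar h₀ H₁ H₂ d e| ≤ dGen ((2 * k : ℕ) : ℝ) d * dGen ((2 * k : ℕ) : ℝ) e / Nat.lcm d e := by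
    unfold pairCoeffStar
    rw [abs_mul, abs_mul, abs_of_nonneg (by positivity :
      (0 : ℝ) ≤ (nuJointStar h₀ H₁ H₂ d e / Nat.totient (Nat.lcm d e) : ℝ))]
    calc |(μ d : ℝ)| * |(μ e : ℝ)| * (nuJointStar h₀ H₁ H₂ d e / Nat.totient (Nat.lcm d e) : ℝ)
        ≤ 1 * 1 * (dGen ((2 * k : ℕ) : ℝ) d * dGen ((2 * k : ℕ) : ℝ) e / Nat.lcm d e) := by
          gcongr
      _ = _ := by ring
  have h2 : dGen ((2 * k : ℕ) : ℝ) d * dGen ((2 * k : ℕ) : ℝ) e / Nat.lcm d e ≤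
      K * K * (((d : ℝ) * e) ^ (1 / 4 : ℝ) * ((d : ℝ) * e) ^ (1 / 2 : ℝ)) / ((d : ℝ) * e) := by
    rw [div_le_div_iff₀ hlcm0 hde]
    have hνν : dGen ((2 * k : ℕ) : ℝ) d * dGen ((2 * k : ℕ) : ℝ) e ≤ K * K * ((d : ℝ) * e) ^ (1 / 4 : ℝ) := by
      calc dGen ((2 * k : ℕ) : ℝ) d * dGen ((2 * k : ℕ) : ℝ) e
          ≤ (K * (d : ℝ) ^ (1 / 4 : ℝ)) * (K * (e : ℝ) ^ (1 / 4 : ℝ)) :=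
            mul_le_mul hνd hνe (pow_nonneg (Nat.cast_nonneg _) _) (by positivity)
        _ = K * K * ((d : ℝ) ^ (1 / 4 : ℝ) * (e : ℝ) ^ (1 / 4 : ℝ)) := by ring
        _ = K * K * ((d : ℝ) * e) ^ (1 / 4 : ℝ) := by rw [Real.mul_rpow hd0.le he0.le]
    calc dGen ((2 * k : ℕ) : ℝ) d * dGen ((2 * k : ℕ) : ℝ) e * ((d : ℝ) * e)
        = dGen ((2 * k : ℕ) : ℝ) d * dGen ((2 * k : ℕ) : ℝ) e * Nat.gcd d e * Nat.lcm d e := by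
          rw [← hprod]; ring
      _ ≤ (K * K * ((d : ℝ) * e) ^ (1 / 4 : ℝ)) * ((d : ℝ) * e) ^ (1 / 2 : ℝ) * Nat.lcm d e := by
          refine mul_le_mul_of_nonneg_right ?_ hlcm0.le
          exact mul_le_mul hνν hgcd (Nat.cast_nonneg _) (by positivity)
      _ = K * K * (((d : ℝ) * e) ^ (1 / 4 : ℝ) * ((d : ℝ) * e) ^ (1 / 2 : ℝ)) * Nat.lcm d e := by ring
  have h3 : ((d : ℝ) * e) ^ (1 / 4 : ℝ) * ((d : ℝ) * e) ^ (1 / 2 : ℝ) / ((d : ℝ) * e) =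
      (((d : ℝ) * e) ^ (1 / 4 : ℝ))⁻¹ := by
    rw [← Real.rpow_add hde, ← Real.rpow_neg hde.le, div_eq_iff hde.ne', ← Real.rpow_add_one hde.ne']
    norm_num
  calc |pairCoeffStar h₀ H₁ H₂ d e| ≤ dGen ((2 * k : ℕ) : ℝ) d * dGen ((2 * k : ℕ) : ℝ) e / Nat.lcm d e := h1
    _ ≤ K * K * (((d : ℝ) * e) ^ (1 / 4 : ℝ) * ((d : ℝ) * e) ^ (1 / 2 : ℝ)) / ((d : ℝ) * e) := h2
    _ = K * K * (((d : ℝ) * e) ^ (1 / 4 : ℝ))⁻¹ := by rw [mul_div_assoc, h3]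

/-- **`∑_{d,e ≥ 1} |c*(d,e)|/(de) < ∞`** (comparison with `K'² ∑_d d^{−5/4} ∑_e e^{−5/4}`).
[cite: GoldstonPintzYildirim2009, Section 9 eq. 9.15] -/
theorem summable_abs_pairCoeffStar_div (h₀ : ℕ) (H₁ H₂ : Finset ℕ) (hk : 1 ≤ #H₁ + #H₂) :
    Summable fun p : ℕ × ℕ => |pairCoeffStar h₀ H₁ H₂ p.1 p.2| / ((p.1 : ℝ) * p.2) := by
  set K : ℝ := ((2 * (#H₁ + #H₂) : ℕ) : ℝ) ^ ((2 * (#H₁ + #H₂)) ^ 4) *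
    ((2 * (#H₁ + #H₂) : ℕ) : ℝ) ^ ((2 * (#H₁ + #H₂)) ^ 4) with hKdef
  have hs : Summable fun d : ℕ => ((d : ℝ) ^ (5 / 4 : ℝ))⁻¹ :=
    Real.summable_nat_rpow_inv.2 (by norm_num)
  have hprod : Summable fun p : ℕ × ℕ => ((p.1 : ℝ) ^ (5 / 4 : ℝ))⁻¹ * ((p.2 : ℝ) ^ (5 / 4 : ℝ))⁻¹ :=
    hs.mul_of_nonneg hs (fun _ => by positivity) (fun _ => by positivity)
  refine Summable.of_nonneg_of_le (fun p => by positivity) (fun p => ?_) (hprod.mul_left K)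
  obtain ⟨d, e⟩ := p
  rcases Nat.eq_zero_or_pos d with rfl | hd
  · simp [pairCoeffStar_zero_left]
  rcases Nat.eq_zero_or_pos e with rfl | he
  · simp [pairCoeffStar_zero_right]
  have hd0 : (0 : ℝ) < d := by exact_mod_cast hd
  have he0 : (0 : ℝ) < e := by exact_mod_cast he
  dsimp only
  calc |pairCoeffStar h₀ H₁ H₂ d e| / ((d : ℝ) * e)
      ≤ K * (((d : ℝ) * e) ^ (1 / 4 : ℝ))⁻¹ / ((d : ℝ) * e) :=
        div_le_div_of_nonneg_right (abs_pairCoeffStar_le h₀ H₁ H₂ hk hd.ne' he.ne') (by positivity)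
    _ = K * (((d : ℝ) ^ (5 / 4 : ℝ))⁻¹ * ((e : ℝ) ^ (5 / 4 : ℝ))⁻¹) := by
        rw [mul_div_assoc, rpow_quarter_inv_div_mul hd0 he0]

/-! ### The double Dirichlet series (9.16) -/

/-- The `(d,e)` term `c*(d,e) d^{−s₁} e^{−s₂}` of the series (9.16).
[cite: GoldstonPintzYildirim2009, Section 9 eq. 9.16] -/
def FDir₂StarTerm (h₀ : ℕ) (H₁ H₂ : Finset ℕ) (s₁ s₂ : ℂ) (p : ℕ × ℕ) : ℂ :=
  (pairCoeffStar h₀ H₁ H₂ p.1 p.2 : ℂ) / ((p.1 : ℂ) ^ s₁ * (p.2 : ℂ) ^ s₂)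

/-- GPY (9.16), left-hand side: `F(s₁,s₂) = ∑_{d,e ≥ 1} μ(d)μ(e)(nuJointStar(d,e)/φ([d,e])) d^{−s₁}e^{−s₂}`
(the printed primed triple sum over pairwise coprime `(a₁,a₂,a₁₂)` in the variables `d = a₁a₁₂`,
`e = a₂a₁₂`, `nuJointStar_eq`), as a `tsum` over `ℕ × ℕ` (absolutely convergent for `Re sᵢ ≥ 1`).
[cite: GoldstonPintzYildirim2009, Section 9 eq. 9.16] -/
def FDir₂Star (h₀ : ℕ) (H₁ H₂ : Finset ℕ) (s₁ s₂ : ℂ) : ℂ :=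
  ∑' p : ℕ × ℕ, FDir₂StarTerm h₀ H₁ H₂ s₁ s₂ p

/-- `‖c*(d,e) d^{−s₁} e^{−s₂}‖ ≤ |c*(d,e)|/(de)` for `Re s₁, Re s₂ ≥ 1`.
[cite: GoldstonPintzYildirim2009, Section 9 eq. 9.16] -/
theorem norm_FDir₂StarTerm_le (h₀ : ℕ) (H₁ H₂ : Finset ℕ) {s₁ s₂ : ℂ} (hs₁ : 1 ≤ s₁.re)
    (hs₂ : 1 ≤ s₂.re) (p : ℕ × ℕ) :
    ‖FDir₂StarTerm h₀ H₁ H₂ s₁ s₂ p‖ ≤ |pairCoeffStar h₀ H₁ H₂ p.1 p.2| / ((p.1 : ℝ) * p.2) := by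
  obtain ⟨d, e⟩ := p
  rcases Nat.eq_zero_or_pos d with rfl | hd
  · simp [FDir₂StarTerm, pairCoeffStar_zero_left]
  rcases Nat.eq_zero_or_pos e with rfl | he
  · simp [FDir₂StarTerm, pairCoeffStar_zero_right]
  have hd0 : (0 : ℝ) < d := by exact_mod_cast hd
  have he0 : (0 : ℝ) < e := by exact_mod_cast he
  dsimp only
  rw [FDir₂StarTerm, norm_div, norm_mul, Complex.norm_real, Real.norm_eq_abs,
    Complex.norm_natCast_cpow_of_pos hd, Complex.norm_natCast_cpow_of_pos he]
  refine div_le_div_of_nonneg_left (abs_nonneg _) (mul_pos hd0 he0) ?_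
  have h1 : (d : ℝ) ≤ (d : ℝ) ^ s₁.re := by
    conv_lhs => rw [← Real.rpow_one (d : ℝ)]
    exact Real.rpow_le_rpow_of_exponent_le (by exact_mod_cast hd) hs₁
  have h2 : (e : ℝ) ≤ (e : ℝ) ^ s₂.re := by
    conv_lhs => rw [← Real.rpow_one (e : ℝ)]
    exact Real.rpow_le_rpow_of_exponent_le (by exact_mod_cast he) hs₂
  exact mul_le_mul h1 h2 he0.le (by positivity)

/-- **Absolute convergence of the series (9.16) for `Re s₁, Re s₂ ≥ 1`** (`k₁ + k₂ ≥ 1`).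
[cite: GoldstonPintzYildirim2009, Section 9 eq. 9.16] -/
theorem summable_norm_FDir₂StarTerm (h₀ : ℕ) (H₁ H₂ : Finset ℕ) (hk : 1 ≤ #H₁ + #H₂) {s₁ s₂ : ℂ}
    (hs₁ : 1 ≤ s₁.re) (hs₂ : 1 ≤ s₂.re) :
    Summable fun p : ℕ × ℕ => ‖FDir₂StarTerm h₀ H₁ H₂ s₁ s₂ p‖ :=
  Summable.of_nonneg_of_le (fun _ => norm_nonneg _) (norm_FDir₂StarTerm_le h₀ H₁ H₂ hs₁ hs₂)
    (summable_abs_pairCoeffStar_div h₀ H₁ H₂ hk)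

/-- The series (9.16) converges for `Re s₁, Re s₂ ≥ 1`. [cite: GoldstonPintzYildirim2009, Section 9 eq. 9.16] -/
theorem summable_FDir₂StarTerm (h₀ : ℕ) (H₁ H₂ : Finset ℕ) (hk : 1 ≤ #H₁ + #H₂) {s₁ s₂ : ℂ}
    (hs₁ : 1 ≤ s₁.re) (hs₂ : 1 ≤ s₂.re) : Summable (FDir₂StarTerm h₀ H₁ H₂ s₁ s₂) :=
  (summable_norm_FDir₂StarTerm h₀ H₁ H₂ hk hs₁ hs₂).of_norm

/-! ### The Euler product (9.16) -/

/-- The terms are pair-multiplicative. [cite: GoldstonPintzYildirim2009, Section 9 eq. 9.16] -/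
theorem isPairMultiplicative_FDir₂StarTerm (h₀ : ℕ) (H₁ H₂ : Finset ℕ) (s₁ s₂ : ℂ) :
    IsPairMultiplicative (FDir₂StarTerm h₀ H₁ H₂ s₁ s₂) := by
  intro m n d₁ e₁ d₂ e₂ hmn hd₁ he₁ hd₂ he₂
  unfold FDir₂StarTerm
  dsimp only
  rw [pairCoeffStar_mul_mul h₀ H₁ H₂ hmn hd₁ he₁ hd₂ he₂]
  push_cast
  rw [Complex.natCast_mul_natCast_cpow, Complex.natCast_mul_natCast_cpow, mul_div_mul_comm]
  ring

/-- `t(1,1) = 1`. [folklore] -/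
theorem FDir₂StarTerm_one_one (h₀ : ℕ) (H₁ H₂ : Finset ℕ) (s₁ s₂ : ℂ) :
    FDir₂StarTerm h₀ H₁ H₂ s₁ s₂ (1, 1) = 1 := by
  simp [FDir₂StarTerm, pairCoeffStar_one_one]

/-- A nonzero term has squarefree `[d,e]` (`μ(d)μ(e) ≠ 0`). [folklore] -/
theorem squarefree_lcm_of_FDir₂StarTerm_ne_zero (h₀ : ℕ) (H₁ H₂ : Finset ℕ) (s₁ s₂ : ℂ) (p : ℕ × ℕ)
    (h : FDir₂StarTerm h₀ H₁ H₂ s₁ s₂ p ≠ 0) : Squarefree (Nat.lcm p.1 p.2) := by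
  obtain ⟨d, e⟩ := p
  have hd : Squarefree d := by
    by_contra hd
    apply h
    simp [FDir₂StarTerm, pairCoeffStar, ArithmeticFunction.moebius_eq_zero_of_not_squarefree hd]
  have he : Squarefree e := by
    by_contra he
    apply h
    simp [FDir₂StarTerm, pairCoeffStar, ArithmeticFunction.moebius_eq_zero_of_not_squarefree he]
  have hd0 := hd.ne_zero
  have he0 := he.ne_zero
  dsimp only
  rw [Nat.squarefree_iff_factorization_le_one (Nat.lcm_ne_zero hd0 he0)]
  intro q
  rw [Nat.factorization_lcm hd0 he0, Finsupp.sup_apply]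
  exact sup_le ((Nat.squarefree_iff_factorization_le_one hd0).1 hd q)
    ((Nat.squarefree_iff_factorization_le_one he0).1 he q)

/-- On the pairs with `d = 0` or `e = 0` the term vanishes. [folklore] -/
theorem FDir₂StarTerm_eq_zero_of_lcm_eq_zero (h₀ : ℕ) (H₁ H₂ : Finset ℕ) (s₁ s₂ : ℂ) (p : ℕ × ℕ)
    (hp : Nat.lcm p.1 p.2 = 0) : FDir₂StarTerm h₀ H₁ H₂ s₁ s₂ p = 0 := by
  obtain ⟨d, e⟩ := p
  rcases Nat.lcm_eq_zero_iff.1 hp with h | h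
  · simp only at h; subst h; simp [FDir₂StarTerm, pairCoeffStar_zero_left]
  · simp only at h; subst h; simp [FDir₂StarTerm, pairCoeffStar_zero_right]

/-- `nuJointStar(p,1) = ν*_p(H₁⁰)`, `nuJointStar(1,p) = ν*_p(H₂⁰)`, `nuJointStar(p,p) = ν̄*_p` at a prime.
[cite: GoldstonPintzYildirim2009, Section 9 eq. 9.11] -/
theorem nuJointStar_prime (h₀ : ℕ) (H₁ H₂ : Finset ℕ) {p : ℕ} (hp : p.Prime) :
    nuJointStar h₀ H₁ H₂ p 1 = nuStarPrime h₀ H₁ p ∧ nuJointStar h₀ H₁ H₂ 1 p = nuStarPrime h₀ H₂ p ∧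
      nuJointStar h₀ H₁ H₂ p p = nuBarStar h₀ H₁ H₂ p := by
  refine ⟨?_, ?_, ?_⟩ <;> simp [nuJointStar, nuJointStarPrime, hp.primeFactors, hp.ne_one]

/-- **The local factor**: `1 + t(p,1) + t(1,p) + t(p,p) = starFactor p s₁ s₂`
(`μ(p) = −1`, `φ(p) = p − 1`). [cite: GoldstonPintzYildirim2009, Section 9 eq. 9.16] -/
theorem one_add_FDir₂StarTerm_prime (h₀ : ℕ) (H₁ H₂ : Finset ℕ) (s₁ s₂ : ℂ) {p : ℕ} (hp : p.Prime) :
    1 + FDir₂StarTerm h₀ H₁ H₂ s₁ s₂ (p, 1) + FDir₂StarTerm h₀ H₁ H₂ s₁ s₂ (1, p) +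
        FDir₂StarTerm h₀ H₁ H₂ s₁ s₂ (p, p) = starFactor h₀ H₁ H₂ p s₁ s₂ := by
  obtain ⟨hν1, hν2, hν12⟩ := nuJointStar_prime h₀ H₁ H₂ hp
  have hp0 : (p : ℂ) ≠ 0 := by exact_mod_cast hp.ne_zero
  have hφ : Nat.totient p = p - 1 := Nat.totient_prime hp
  have hcast : ((p - 1 : ℕ) : ℂ) = (p : ℂ) - 1 := by
    rw [Nat.cast_sub hp.one_lt.le]; simp
  simp only [FDir₂StarTerm, pairCoeffStar, hν1, hν2, hν12, ArithmeticFunction.moebius_apply_prime hp,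
    ArithmeticFunction.moebius_apply_one, Nat.lcm_one_left, Nat.lcm_one_right, Nat.lcm_self,
    Nat.cast_one, Complex.one_cpow, hφ, starFactor]
  push_cast
  rw [hcast, Complex.cpow_add _ _ hp0]
  have hp1 : ((p : ℂ) - 1) ≠ 0 := by
    have : (1 : ℝ) < p := by exact_mod_cast hp.one_lt
    exact_mod_cast (sub_ne_zero.2 (by exact_mod_cast (ne_of_gt this) : (p : ℂ) ≠ 1))
  have hps₁ : (p : ℂ) ^ s₁ ≠ 0 := Complex.cpow_ne_zero_iff.2 (Or.inl hp0)
  have hps₂ : (p : ℂ) ^ s₂ ≠ 0 := Complex.cpow_ne_zero_iff.2 (Or.inl hp0)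
  field_simp
  ring

/-- **GPY (9.16), the Euler product**: for `Re s₁, Re s₂ ≥ 1` (`k₁ + k₂ ≥ 1`),
`HasProd (p ↦ starFactor p s₁ s₂) (F(s₁,s₂))` (the generic `hasProd_one_add_pair`).
[cite: GoldstonPintzYildirim2009, Section 9 eq. 9.16] -/
theorem hasProd_starFactor (h₀ : ℕ) (H₁ H₂ : Finset ℕ) (hk : 1 ≤ #H₁ + #H₂) {s₁ s₂ : ℂ}
    (hs₁ : 1 ≤ s₁.re) (hs₂ : 1 ≤ s₂.re) :
    HasProd (fun p : Nat.Primes => starFactor h₀ H₁ H₂ p s₁ s₂) (FDir₂Star h₀ H₁ H₂ s₁ s₂) := by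
  have h := hasProd_one_add_pair (FDir₂StarTerm_one_one h₀ H₁ H₂ s₁ s₂)
    (isPairMultiplicative_FDir₂StarTerm h₀ H₁ H₂ s₁ s₂)
    (squarefree_lcm_of_FDir₂StarTerm_ne_zero h₀ H₁ H₂ s₁ s₂)
    (summable_norm_FDir₂StarTerm h₀ H₁ H₂ hk hs₁ hs₂)
    (FDir₂StarTerm_eq_zero_of_lcm_eq_zero h₀ H₁ H₂ s₁ s₂)
  have heq : (fun p : Nat.Primes => 1 + FDir₂StarTerm h₀ H₁ H₂ s₁ s₂ (p, 1) +
      FDir₂StarTerm h₀ H₁ H₂ s₁ s₂ (1, p) + FDir₂StarTerm h₀ H₁ H₂ s₁ s₂ (p, p)) =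
      fun p : Nat.Primes => starFactor h₀ H₁ H₂ p s₁ s₂ :=
    funext fun p => one_add_FDir₂StarTerm_prime h₀ H₁ H₂ s₁ s₂ p.2
  rw [heq] at h
  exact h

/-- **GPY (9.16)** as an identity: `F(s₁,s₂) = ∏'_p starFactor p s₁ s₂` for `Re sᵢ ≥ 1`.
[cite: GoldstonPintzYildirim2009, Section 9 eq. 9.16] -/
theorem FDir₂Star_eq_tprod (h₀ : ℕ) (H₁ H₂ : Finset ℕ) (hk : 1 ≤ #H₁ + #H₂) {s₁ s₂ : ℂ}
    (hs₁ : 1 ≤ s₁.re) (hs₂ : 1 ≤ s₂.re) :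
    FDir₂Star h₀ H₁ H₂ s₁ s₂ = ∏' p : Nat.Primes, starFactor h₀ H₁ H₂ p s₁ s₂ :=
  (hasProd_starFactor h₀ H₁ H₂ hk hs₁ hs₂).tprod_eq.symm

/-! ### (9.17)–(9.19): `F = G ζ(1+s₁+s₂)^d/(ζ(1+s₁)^a ζ(1+s₂)^b)` -/

/-- **(9.17)–(9.19), product form**: for `Re s₁, Re s₂ ≥ 1` and any exponents `(a, b, d)`,
`HasProd starGFactor (F(s₁,s₂) · ζ(1+s₁)^a · ζ(1+s₂)^b · ζ(1+s₁+s₂)^{−d})`.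
[cite: GoldstonPintzYildirim2009, Section 9 eq. 9.17] -/
theorem hasProd_starGFactor_of_one_le (h₀ : ℕ) (H₁ H₂ : Finset ℕ) (hk : 1 ≤ #H₁ + #H₂) (a b d : ℕ)
    {s₁ s₂ : ℂ} (hs₁ : 1 ≤ s₁.re) (hs₂ : 1 ≤ s₂.re) :
    HasProd (fun p : Nat.Primes => starGFactor h₀ H₁ H₂ a b d p s₁ s₂)
      (FDir₂Star h₀ H₁ H₂ s₁ s₂ * riemannZeta (1 + s₁) ^ a * riemannZeta (1 + s₂) ^ b *
        (riemannZeta (1 + s₁ + s₂))⁻¹ ^ d) := by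
  have hF := hasProd_starFactor h₀ H₁ H₂ hk hs₁ hs₂
  have h12 : 1 < (1 + s₁ + s₂).re := by simp only [Complex.add_re, Complex.one_re]; linarith
  have h1 : 1 < (1 + s₁).re := by simp only [Complex.add_re, Complex.one_re]; linarith
  have h2 : 1 < (1 + s₂).re := by simp only [Complex.add_re, Complex.one_re]; linarith
  have hZ := hasProd_one_sub_inv_riemannZeta h12
  have hζ1 := riemannZeta_eulerProduct_hasProd h1
  have hζ2 := riemannZeta_eulerProduct_hasProd h2
  exact ((hF.mul (hζ1.pow a)).mul (hζ2.pow b)).mul (hZ.pow d)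

/-- **GPY (9.17)–(9.19)**: `F(s₁,s₂) = G(s₁,s₂) ζ(1+s₁+s₂)^d/(ζ(1+s₁)^a ζ(1+s₂)^b)` for
`Re s₁, Re s₂ ≥ 1`, `G = GStar h₀ H₁ H₂ a b d` (any exponents; for Proposition 2 the case
exponents `caseA h₀ H₁, caseA h₀ H₂, caseD h₀ H₁ H₂`). [cite: GoldstonPintzYildirim2009, Section 9 eq. 9.17] -/
theorem FDir₂Star_eq_GStar_mul (h₀ : ℕ) (H₁ H₂ : Finset ℕ) (hk : 1 ≤ #H₁ + #H₂) (a b d : ℕ)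
    {s₁ s₂ : ℂ} (hs₁ : 1 ≤ s₁.re) (hs₂ : 1 ≤ s₂.re) :
    FDir₂Star h₀ H₁ H₂ s₁ s₂ = GStar h₀ H₁ H₂ a b d s₁ s₂ * riemannZeta (1 + s₁ + s₂) ^ d /
      (riemannZeta (1 + s₁) ^ a * riemannZeta (1 + s₂) ^ b) := by
  have h12 : 1 < (1 + s₁ + s₂).re := by simp only [Complex.add_re, Complex.one_re]; linarith
  have h1 : 1 < (1 + s₁).re := by simp only [Complex.add_re, Complex.one_re]; linarith
  have h2 : 1 < (1 + s₂).re := by simp only [Complex.add_re, Complex.one_re]; linarith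
  have hz12 := riemannZeta_ne_zero_of_one_lt_re h12
  have hz1 := riemannZeta_ne_zero_of_one_lt_re h1
  have hz2 := riemannZeta_ne_zero_of_one_lt_re h2
  rw [GStar, (hasProd_starGFactor_of_one_le h₀ H₁ H₂ hk a b d hs₁ hs₂).tprod_eq,
    eq_div_iff (mul_ne_zero (pow_ne_zero _ hz1) (pow_ne_zero _ hz2))]
  have hζ12r : (riemannZeta (1 + s₁ + s₂))⁻¹ ^ d * riemannZeta (1 + s₁ + s₂) ^ d = 1 := by
    rw [← mul_pow, inv_mul_cancel₀ hz12, one_pow]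
  calc FDir₂Star h₀ H₁ H₂ s₁ s₂ * (riemannZeta (1 + s₁) ^ a * riemannZeta (1 + s₂) ^ b)
      = FDir₂Star h₀ H₁ H₂ s₁ s₂ * (riemannZeta (1 + s₁) ^ a * riemannZeta (1 + s₂) ^ b) *
          ((riemannZeta (1 + s₁ + s₂))⁻¹ ^ d * riemannZeta (1 + s₁ + s₂) ^ d) := by
        rw [hζ12r, mul_one]
    _ = _ := by ring

end Literature.NumberTheory.Sieve.GPY
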